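import Summits.CriticalPhenomena.CardyFormulaZ2.Theorems.CardyIKTransportIKLinearTransportStubCoalescingRowKernelForcing

/-!
# Stub `stub_CoalescingRowKernel` (A_dyn') — part G: REROUTING monochromatic strip paths to one side of a
# cut row

Support file (`--supports stmt-CriticalPhenomena-5076`, registered sub-goal `isCut_reroute`), the GRAPH
HALF of the remaining cut-Markov property (K) of `…Reduction.lean`. If `c` is a cut row of the pinned
statistic of `x`, then two strip cells of one colour lying weakly ABOVE row `c` (rows `≥ c`) are joined by a
monochromatic strip path iff they are joined by one staying weakly above row `c`; likewise weakly below.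
Hence the strip diagram of `x` restricted to boundary pairs on one side of the cut is computed on that side:
with the forcing of the middle colours (`isCut_forces_mid`) and the bichromatic faces of the face rows
`c-1, c` (`isCut_faces_bichromatic`), this is the factorisation of the diagram constraint across a cut row.

Proof (`crk_reroute_abstract`, for any graph whose edges change an integer `row` by at most one): follow the
path and remember, while it is strictly below row `c`, the row-`c` vertex `X` through which it left; it can
only come back through a row-`c` vertex `Y` joined to `X` below row `c`; the SEPARATION hypothesis "two such
row-`c` vertices coincide" then closes the induction. For the strip under a cut row the separation holds
(`crk_rowc_sep`): the row-`c` strip cells of the path's colour are either the single middle cell (colour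
`¬col`) or the two boundary cells (colour `col`), and the latter are NOT joined inside the strip since
`((i,c),(i+2,c)) ∉ stripDiagram i x`. The lower side is the upper side for the row function `-row`.
-/

noncomputable section

namespace Summit.CriticalPhenomena.CardyFormulaZ2.Theorems.IKLinearTransport.PinnedDiagramExchange

open scoped Classical MeasureTheory ENNReal symmDiff
open Set MeasureTheory
open Literature.Probability.Percolation Literature.Probability.LatticeModels

/-! ## The abstract rerouting lemma -/

/-- REROUTING, ABSTRACT FORM: in a graph whose edges change `row` by at most one, if any two row-`c` vertices
of `s` joined inside `s ∩ {row ≤ c}` coincide, then two vertices of `s ∩ {c ≤ row}` joined inside `s` are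
joined inside `s ∩ {c ≤ row}`. [folklore] -/
theorem crk_reroute_abstract {V : Type*} (G : SimpleGraph V) (row : V → ℤ)
    (hG : ∀ u v, G.Adj u v → row v ≤ row u + 1 ∧ row u ≤ row v + 1) (s : Set V) (c : ℤ)
    (hsep : ∀ X Y, X ∈ s → Y ∈ s → row X = c → row Y = c →
      (SDE.within G (s ∩ {v | row v ≤ c})).Reachable X Y → X = Y)
    {P Q : V} (hP : P ∈ s ∧ c ≤ row P) (hQ : Q ∈ s ∧ c ≤ row Q) (h : (SDE.within G s).Reachable P Q) :
    (SDE.within G (s ∩ {v | c ≤ row v})).Reachable P Q := by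
  set U : Set V := s ∩ {v | c ≤ row v} with hU
  set Lo : Set V := s ∩ {v | row v ≤ c} with hLo
  -- the invariant along the walk
  suffices key : (c ≤ row Q → (SDE.within G U).Reachable P Q) ∧
      (row Q < c → ∃ X, X ∈ s ∧ row X = c ∧ (SDE.within G U).Reachable P X ∧ (SDE.within G Lo).Reachable X Q) from
    key.1 hQ.2
  clear hQ
  rw [SimpleGraph.reachable_iff_reflTransGen] at h
  induction h with
  | refl => exact ⟨fun _ => SimpleGraph.Reachable.refl _, fun h' => absurd hP.2 (not_le.2 h')⟩
  | @tail b b' _ hbb' ih =>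
    obtain ⟨hadj, hb, hb'⟩ := hbb'
    obtain ⟨hr1, hr2⟩ := hG b b' hadj
    refine ⟨fun hcb' => ?_, fun hcb' => ?_⟩
    · by_cases hcb : c ≤ row b
      · exact (ih.1 hcb).trans (SimpleGraph.Adj.reachable ⟨hadj, ⟨hb, hcb⟩, ⟨hb', hcb'⟩⟩)
      · replace hcb : row b < c := not_le.1 hcb
        obtain ⟨X, hXs, hXc, hPX, hXb⟩ := ih.2 hcb
        have hrow : row b' = c := by omega
        have hXb' : (SDE.within G Lo).Reachable X b' :=
          hXb.trans (SimpleGraph.Adj.reachable ⟨hadj, ⟨hb, hcb.le⟩, ⟨hb', hrow.le⟩⟩)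
        rw [← hsep X b' hXs hb' hXc hrow hXb']
        exact hPX
    · by_cases hcb : c ≤ row b
      · have hrow : row b = c := by omega
        exact ⟨b, hb, hrow, ih.1 hcb, SimpleGraph.Adj.reachable ⟨hadj, ⟨hb, hrow.le⟩, ⟨hb', hcb'.le⟩⟩⟩
      · replace hcb : row b < c := not_le.1 hcb
        obtain ⟨X, hXs, hXc, hPX, hXb⟩ := ih.2 hcb
        exact ⟨X, hXs, hXc, hPX, hXb.trans (SimpleGraph.Adj.reachable ⟨hadj, ⟨hb, hcb.le⟩, ⟨hb', hcb'.le⟩⟩)⟩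

/-- The abstract lemma for the lower side (row function `-row`). [folklore] -/
theorem crk_reroute_abstract_lower {V : Type*} (G : SimpleGraph V) (row : V → ℤ)
    (hG : ∀ u v, G.Adj u v → row v ≤ row u + 1 ∧ row u ≤ row v + 1) (s : Set V) (c : ℤ)
    (hsep : ∀ X Y, X ∈ s → Y ∈ s → row X = c → row Y = c →
      (SDE.within G (s ∩ {v | c ≤ row v})).Reachable X Y → X = Y)
    {P Q : V} (hP : P ∈ s ∧ row P ≤ c) (hQ : Q ∈ s ∧ row Q ≤ c) (h : (SDE.within G s).Reachable P Q) :
    (SDE.within G (s ∩ {v | row v ≤ c})).Reachable P Q := by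
  have e1 : {v : V | -c ≤ -row v} = {v | row v ≤ c} := by ext v; simp only [mem_setOf_eq]; omega
  have e2 : {v : V | -row v ≤ -c} = {v | c ≤ row v} := by ext v; simp only [mem_setOf_eq]; omega
  have := crk_reroute_abstract G (fun v => -row v) (fun u v huv => by have := hG u v huv; omega) s (-c)
    (fun X Y hX hY hXc hYc hr => hsep X Y hX hY (by omega) (by omega) (by rwa [e2] at hr))
    (P := P) (Q := Q) ⟨hP.1, by omega⟩ ⟨hQ.1, by omega⟩ h
  rwa [e1] at this

/-! ## The strip under a cut row -/

/-- The monochromatic strip set of colour `κ`. [folklore] -/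
def crkStrip (i : ℤ) (x : Obs) (κ : Prop) : Set (Site 2) := {v | (v ∈ x.1 ↔ κ) ∧ i ≤ v 0 ∧ v 0 ≤ i + 2}

/-- Strip-diagram membership as reachability inside the strip set. [folklore] -/
theorem crk_mem_stripDiagram_of_within (i : ℤ) (x : Obs) (κ : Prop) {P Q : Site 2}
    (hP0 : P 0 = i ∨ P 0 = i + 2) (hQ0 : Q 0 = i ∨ Q 0 = i + 2) (hP : P ∈ crkStrip i x κ) (hQ : Q ∈ crkStrip i x κ)
    {t : Set (Site 2)} (ht : t ⊆ crkStrip i x κ) (h : (SDE.within (cellGraph x.2) t).Reachable P Q) :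
    (P, Q) ∈ stripDiagram i x := by
  have hs : crkStrip i x κ = {v | (v ∈ x.1 ↔ P ∈ x.1) ∧ i ≤ v 0 ∧ v 0 ≤ i + 2} := by
    ext v; simp only [crkStrip, mem_setOf_eq, hP.1]
  have h' : (SDE.within (cellGraph x.2) {v | (v ∈ x.1 ↔ P ∈ x.1) ∧ i ≤ v 0 ∧ v 0 ≤ i + 2}).Reachable P Q := by
    rw [← hs]; exact SDE.within_mono _ ht h
  have hQ' : (Q ∈ x.1 ↔ P ∈ x.1) ∧ i ≤ Q 0 ∧ Q 0 ≤ i + 2 := ⟨hQ.1.trans hP.1.symm, hQ.2.1, hQ.2.2⟩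
  rw [stripDiagram, mem_setOf_eq]
  dsimp only
  refine ⟨hP0, hQ0, ?_⟩
  refine ⟨hQ', ?_⟩
  refine ⟨⟨hP.2.1, hP.2.2⟩, ?_⟩
  exact (SDE.induce_reachable_iff (cellGraph x.2) {v | (v ∈ x.1 ↔ P ∈ x.1) ∧ i ≤ v 0 ∧ v 0 ≤ i + 2}
    (u := P) (v := Q) ⟨Iff.rfl, hP.2.1, hP.2.2⟩ hQ').2 h'

/-- SEPARATION AT A CUT ROW: two row-`c` strip cells of one colour joined inside any part of the strip set
coincide (the middle cell has the colour opposite to the two boundary cells, which are not joined). [folklore] -/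
theorem crk_rowc_sep (i c : ℤ) (x : Obs) (hcut : IsCut i c (pinnedStat i x)) (κ : Prop) {t : Set (Site 2)}
    (ht : t ⊆ crkStrip i x κ) (X Y : Site 2) (hX : X ∈ crkStrip i x κ) (hY : Y ∈ crkStrip i x κ)
    (hXc : X 1 = c) (hYc : Y 1 = c) (h : (SDE.within (cellGraph x.2) t).Reachable X Y) : X = Y := by
  have hi : (i : ℤ) ≠ i + 1 := by omega
  have hi2 : (i + 2 : ℤ) ≠ i + 1 := by omega
  have hM : (![i + 1, c] : Site 2) ∈ x.1 ↔ (![i, c] : Site 2) ∉ x.1 := isCut_forces_mid i c x hcut c (by omega) (by omega)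
  obtain ⟨hbd, -, -, hnot, -⟩ := hcut
  simp only [pinnedStat, crk_mem_eraseMid_fst i x _ _ hi, crk_mem_eraseMid_fst i x _ _ hi2] at hbd
  have hR : (![i + 2, c] : Site 2) ∈ x.1 ↔ (![i, c] : Site 2) ∈ x.1 := (hbd c (by omega) (by omega)).2
  have hnot' : ((![i, c], ![i + 2, c]) : Site 2 × Site 2) ∉ stripDiagram i x := hnot
  have hXe : X = ![X 0, c] := by rw [← hXc]; exact (SDE.site2_eta X).symm
  have hYe : Y = ![Y 0, c] := by rw [← hYc]; exact (SDE.site2_eta Y).symm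
  -- colour bookkeeping: a row-`c` strip cell of colour `κ` is the middle cell iff `κ = ¬col`
  have hcolX := hX.1
  have hcolY := hY.1
  by_cases hX0 : X 0 = i + 1
  · by_cases hY0 : Y 0 = i + 1
    · rw [hXe, hYe, hX0, hY0]
    · exfalso
      rw [hXe, hX0] at hcolX
      rcases (show Y 0 = i ∨ Y 0 = i + 2 by have := hY.2.1; have := hY.2.2; omega) with h0 | h0
      · rw [hYe, h0] at hcolY; exact iff_not_self ((hcolY.trans hcolX.symm).trans hM)
      · rw [hYe, h0] at hcolY
        exact iff_not_self (((hR.symm.trans hcolY).trans hcolX.symm).trans hM)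
  · by_cases hY0 : Y 0 = i + 1
    · exfalso
      rw [hYe, hY0] at hcolY
      rcases (show X 0 = i ∨ X 0 = i + 2 by have := hX.2.1; have := hX.2.2; omega) with h0 | h0
      · rw [hXe, h0] at hcolX; exact iff_not_self ((hcolX.trans hcolY.symm).trans hM)
      · rw [hXe, h0] at hcolX
        exact iff_not_self (((hR.symm.trans hcolX).trans hcolY.symm).trans hM)
    · -- both are boundary cells of row `c`
      rcases (show X 0 = i ∨ X 0 = i + 2 by have := hX.2.1; have := hX.2.2; omega) with hx | hx <;>
        rcases (show Y 0 = i ∨ Y 0 = i + 2 by have := hY.2.1; have := hY.2.2; omega) with hy | hy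
      · rw [hXe, hYe, hx, hy]
      · exfalso
        refine hnot' ?_
        have := crk_mem_stripDiagram_of_within i x κ (P := X) (Q := Y) (by omega) (by omega) hX hY ht h
        rwa [hXe, hYe, hx, hy] at this
      · exfalso
        refine hnot' ?_
        have := crk_mem_stripDiagram_of_within i x κ (P := Y) (Q := X) (by omega) (by omega) hY hX ht h.symm
        rwa [hXe, hYe, hx, hy] at this
      · rw [hXe, hYe, hx, hy]

/-- REROUTING AT A CUT ROW (registered sub-goal `isCut_reroute`): if `c` is a cut row of the pinned statistic
of `x`, two strip cells of one colour weakly above (resp. weakly below) row `c` that are joined by a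
monochromatic strip path are joined by one staying weakly above (resp. below) row `c`. [folklore] -/
theorem isCut_reroute : ∀ (i c : ℤ) (x : Obs), IsCut i c (pinnedStat i x) → ∀ (κ : Prop) (P Q : Site 2),
    P ∈ crkStrip i x κ → Q ∈ crkStrip i x κ → (SDE.within (cellGraph x.2) (crkStrip i x κ)).Reachable P Q →
    ((c ≤ P 1 → c ≤ Q 1 → (SDE.within (cellGraph x.2) (crkStrip i x κ ∩ {v | c ≤ v 1})).Reachable P Q) ∧
     (P 1 ≤ c → Q 1 ≤ c → (SDE.within (cellGraph x.2) (crkStrip i x κ ∩ {v | v 1 ≤ c})).Reachable P Q)) := by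
  intro i c x hcut κ P Q hP hQ h
  have hG : ∀ u v : Site 2, (cellGraph x.2).Adj u v → v 1 ≤ u 1 + 1 ∧ u 1 ≤ v 1 + 1 := fun u v huv =>
    ⟨(crk_adj_near huv).1, (crk_adj_near huv).2.1⟩
  refine ⟨fun hPc hQc => ?_, fun hPc hQc => ?_⟩
  · exact crk_reroute_abstract (cellGraph x.2) (fun v => v 1) hG (crkStrip i x κ) c
      (fun X Y hX hY hXc hYc hr => crk_rowc_sep i c x hcut κ inter_subset_left X Y hX hY hXc hYc hr)
      ⟨hP, hPc⟩ ⟨hQ, hQc⟩ h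
  · exact crk_reroute_abstract_lower (cellGraph x.2) (fun v => v 1) hG (crkStrip i x κ) c
      (fun X Y hX hY hXc hYc hr => crk_rowc_sep i c x hcut κ inter_subset_left X Y hX hY hXc hYc hr)
      ⟨hP, hPc⟩ ⟨hQ, hQc⟩ h

end Summit.CriticalPhenomena.CardyFormulaZ2.Theorems.IKLinearTransport.PinnedDiagramExchange
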